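import Literature.Geometry.DiscreteGeometry.HeitmannRadinHexagon
import HarnessLib

/-!
# Sticky-disc ground states at De Luca–Friesecke's particle numbers are Harborth spiral configurations

Topic `Literature/Geometry/DiscreteGeometry`; sequel to `HeitmannRadinHexagon.lean` (the hexagonal
numbers `3k(k+1)+1`).  De Luca–Friesecke [LucaFriesecke2017, Theorem 1.1]: the minimizers of the
Heitmann–Radin energy with `N` particles are unique up to rotation and translation iff
(a) `N = 3s² + 3s + 1` or (b) `N = 3s² + 3s + 1 + (s+1)k + s`, `k ∈ {0,…,4}`.  This file proves the
"if" direction in the following concrete form: **every maximal configuration of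
`N = 3s² + 3s + 1 + (s+1)k + s` unit discs (`k ≤ 4`) is a congruent copy of Harborth's spiral
configuration `config (s+1) ((k+1)(s+1) − 1)`** — the hexagon `H_s` together with the first
`(k+1)(s+1) − 1` discs of the next ring (`HexagonalSpiral.lean`), i.e. `k` complete sides of ring
`s + 1` and one more side short of its final corner.

## Proof ([LucaFriesecke2017, §2: Lemma 2.1 and the induction on `s = s(N)` after it], formalized as the
peeling induction of `HeitmannRadinHexagon.lean`)

Write `N(s,k) = 3s² + 3s + 1 + (s+1)k + s`.  For `s ≥ 1` a maximal configuration with `N(s,k)` discs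
has `a = ⌈√(12N−3)⌉ − 3 = 6s + 1 + k` boundary discs (Heitmann–Radin (2)(b)), and
`[3N − √(12N−3)] − 3a + 6 = [3(N−a) − √(12(N−a)−3)]` with `N − a = N(s−1,k)`: by Harborth's
bookkeeping the interior configuration is again maximal, with the PREVIOUS number of the same
family.  By induction it is a copy of `config s (k s + s − 1)` in the lattice frame of the
configuration; every interior disc has its six lattice neighbours present, and the lattice
neighbourhood of `config s (ks + s − 1)` contains `config (s+1) (k(s+1) + s)`
(`exists_adj_of_mem_config`), a set of exactly `N(s,k)` labels — so the configuration IS that copy.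
This is De Luca–Friesecke's induction (`X' := X ∖ ∂X` is a minimizer with `N(s−1,k)` particles and
`X = X' ∪ {x ∈ 𝓛 : dist(x, X') = 1}`, their Lemma 2.1).  The induction starts at `s = 0` (`N = k + 1 ≤ 5`
discs: a disc with `k` consecutive neighbours — `base_zero` … `base_four`; for `N = 4, 5` a disc with
`≥ 3` neighbours exists by counting and the finitely many label sets inside `H₂` are enumerated by
`decide`) and treats `(s,k) = (1,0)` (`N = 8`: the hexagon `H₁` and one more disc touching two of its
discs, `eq_image_config_eight`) separately ("the claim is satisfied for `s = 0, 1`", loc. cit.).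
Rotations are carried by the frame: `config` is not rotation invariant, and the frame direction `u`
is replaced by `u ζ^j` where needed (`framePt_rot6`).

## Main statements

* `HarborthSpiral.exists_adj_of_mem_config` — `config (s+1) (k(s+1)+s) ⊆ config s (ks+s−1) ∪ N(config s (ks+s−1))`
  (`s ≥ 1`, `k ≤ 4`, `(s,k) ≠ (1,0)`);
* `Harborth.typeB`, `card_config_typeB`, `ceil_sqrt_typeB`, `harborthNumber_typeB` — the arithmetic of
  `N(s,k)`: `#config (s+1) (k(s+1)+s) = N`, `⌈√(12N−3)⌉ = 6s + 4 + k`, `[3N − √(12N−3)] = 3N − (6s + 4 + k)`;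
* `Harborth.eq_image_config_of_frame'` — the induction, for configurations inside a lattice frame;
* `Harborth.eq_image_config_of_maximal` — **every maximal configuration of `N(s,k)` unit discs, `k ≤ 4`,
  is `Φ_{t,u}(config (s+1) (k(s+1)+s))` for a frame `(t,u)`, `|u| = 1`**;
* `HarborthSpiral.labels_base_three`, `labels_base_four` — four labels with `5` contacts / five labels
  with `7` contacts are rotated translates of `config 1 3` / `config 1 4`.

Everything here is proved; no new facts (D-0026).  Consumer:
`LucaFriesecke2017.isUniqueUpToRigidMotion_of_typeB` (`StickyDiscUniqueGroundStates.lean`).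
-/

noncomputable section

namespace Literature.Geometry.DiscreteGeometry

open Complex Finset
open scoped Real

/-! ## §1 Labels: the rotation `(m,n) ↦ (−n, m+n)` and the growth of spiral configurations -/

namespace HarborthSpiral

/-- Multiplication by `ζ = e^{iπ/3}` on labels: `(m + nζ)ζ = −n + (m+n)ζ` (`ζ² = ζ − 1`).
[cite: HeitmannRadin1980, §2 (p. 283)] -/
def rot6 (q : ℤ × ℤ) : ℤ × ℤ := (-q.2, q.1 + q.2)

/-- The inverse rotation `(m,n) ↦ (m+n, −m)`. [cite: HeitmannRadin1980, §2 (p. 283)] -/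
def rot6inv (q : ℤ × ℤ) : ℤ × ℤ := (q.1 + q.2, -q.1)

/-- `rot6 (rot6inv q) = q`. [cite: HeitmannRadin1980, §2 (p. 283)] -/
@[simp] theorem rot6_rot6inv (q : ℤ × ℤ) : rot6 (rot6inv q) = q := by
  obtain ⟨m, n⟩ := q; simp [rot6, rot6inv]

/-- `rot6inv (rot6 q) = q`. [cite: HeitmannRadin1980, §2 (p. 283)] -/
@[simp] theorem rot6inv_rot6 (q : ℤ × ℤ) : rot6inv (rot6 q) = q := by
  obtain ⟨m, n⟩ := q; simp [rot6, rot6inv]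

/-- Iterates of the two rotations cancel. [cite: HeitmannRadin1980, §2 (p. 283)] -/
theorem rot6_iterate_rot6inv_iterate (j : ℕ) (q : ℤ × ℤ) : rot6^[j] (rot6inv^[j] q) = q := by
  induction j generalizing q with
  | zero => rfl
  | succ j ih =>
    rw [Function.iterate_succ_apply, Function.iterate_succ_apply', rot6_rot6inv, ih]

/-! ### Positions along the inner ring, chart by chart -/

/-- Position on the top side (chart A). [cite: Harborth1974, p. 15] -/
theorem pos_eq_of_A {r a b : ℤ} (h1 : b = r) (h2 : 1 - r ≤ a) (h3 : a ≤ 0) :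
    pos r (a, b) = a + r - 1 := by
  simp only [pos]; split_ifs <;> omega

/-- Position on side 2 (chart B). [cite: Harborth1974, p. 15] -/
theorem pos_eq_of_B {r a b : ℤ} (h1 : 1 ≤ a) (h2 : 0 ≤ b) (h3 : a + b = r) :
    pos r (a, b) = r - 1 + a := by
  simp only [pos]; split_ifs <;> omega

/-- Position on side 3 (chart C). [cite: Harborth1974, p. 15] -/
theorem pos_eq_of_C {r a b : ℤ} (hr : 1 ≤ r) (h1 : a = r) (h2 : -r ≤ b) (h3 : b ≤ -1) :
    pos r (a, b) = 2 * r - 1 - b := by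
  simp only [pos]; split_ifs <;> omega

/-- Position on side 4 (chart D). [cite: Harborth1974, p. 15] -/
theorem pos_eq_of_D {r a b : ℤ} (hr : 1 ≤ r) (h1 : b = -r) (h2 : 0 ≤ a) (h3 : a ≤ r - 1) :
    pos r (a, b) = 4 * r - 1 - a := by
  simp only [pos]; split_ifs <;> omega

/-- Position on side 5 (chart E). [cite: Harborth1974, p. 15] -/
theorem pos_eq_of_E {r a b : ℤ} (hr : 1 ≤ r) (h1 : a + b = -r) (h2 : -r ≤ a) (h3 : a ≤ -1) :
    pos r (a, b) = 4 * r - 1 - a := by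
  simp only [pos]; split_ifs <;> omega

/-! ### One step inwards from ring `s + 1` to the first `ks + s − 1` labels of ring `s` -/

section Grow

variable {s K k m n : ℤ} (hs : 1 ≤ s)
  (hK : k = 0 ∧ K = 0 ∨ k = 1 ∧ K = s ∨ k = 2 ∧ K = 2 * s ∨ k = 3 ∧ K = 3 * s ∨ k = 4 ∧ K = 4 * s)
include hs hK

/-- Chart A of ring `s+1` (top side). [cite: Harborth1974, p. 15] -/
theorem grow_A (hsk : ¬ (s = 1 ∧ k = 0)) (hA : n = s + 1 ∧ 1 - (s + 1) ≤ m ∧ m ≤ 0)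
    (hpos : m + (s + 1) - 1 < K + k + s) :
    ∃ p : ℤ × ℤ, Inside s p ∧ pos s p < K + s - 1 ∧ (m, n) ∈ nbrs p := by
  by_cases hm : m = -s
  · refine ⟨(m + 1, n - 1), by simp only [Inside]; omega, ?_, by simp [nbrs]⟩
    rw [pos_eq_of_A (by omega) (by omega) (by omega)]; omega
  · refine ⟨(m, n - 1), by simp only [Inside]; omega, ?_, by simp [nbrs]⟩
    rw [pos_eq_of_A (by omega) (by omega) (by omega)]; omega

/-- Chart B of ring `s+1` (side 2). [cite: Harborth1974, p. 15] -/
theorem grow_B (hB : 1 ≤ m ∧ 0 ≤ n ∧ m + n = s + 1) (hpos : s + 1 - 1 + m < K + k + s) :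
    ∃ p : ℤ × ℤ, Inside s p ∧ pos s p < K + s - 1 ∧ (m, n) ∈ nbrs p := by
  refine ⟨(m - 1, n), by simp only [Inside]; omega, ?_, by simp [nbrs]⟩
  by_cases hm : m = 1
  · rw [pos_eq_of_A (by omega) (by omega) (by omega)]; omega
  · rw [pos_eq_of_B (by omega) (by omega) (by omega)]; omega

/-- Chart C of ring `s+1` (side 3). [cite: Harborth1974, p. 15] -/
theorem grow_C (hC : m = s + 1 ∧ -(s + 1) ≤ n ∧ n ≤ -1) (hpos : 2 * (s + 1) - 1 - n < K + k + s) :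
    ∃ p : ℤ × ℤ, Inside s p ∧ pos s p < K + s - 1 ∧ (m, n) ∈ nbrs p := by
  refine ⟨(m - 1, n + 1), by simp only [Inside]; omega, ?_, by simp [nbrs]⟩
  by_cases hn : n = -1
  · rw [pos_eq_of_B (by omega) (by omega) (by omega)]; omega
  · rw [pos_eq_of_C hs (by omega) (by omega) (by omega)]; omega

/-- Chart D of ring `s+1` (side 4). [cite: Harborth1974, p. 15] -/
theorem grow_D (hD : n = -(s + 1) ∧ 0 ≤ m ∧ m ≤ s + 1 - 1) (hpos : 4 * (s + 1) - 1 - m < K + k + s) :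
    ∃ p : ℤ × ℤ, Inside s p ∧ pos s p < K + s - 1 ∧ (m, n) ∈ nbrs p := by
  refine ⟨(m, n + 1), by simp only [Inside]; omega, ?_, by simp [nbrs]⟩
  by_cases hm : m = s
  · rw [pos_eq_of_C hs (by omega) (by omega) (by omega)]; omega
  · rw [pos_eq_of_D hs (by omega) (by omega) (by omega)]; omega

/-- Chart E of ring `s+1` (side 5). [cite: Harborth1974, p. 15] -/
theorem grow_E (hE : m + n = -(s + 1) ∧ -(s + 1) ≤ m ∧ m ≤ -1) (hpos : 4 * (s + 1) - 1 - m < K + k + s) :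
    ∃ p : ℤ × ℤ, Inside s p ∧ pos s p < K + s - 1 ∧ (m, n) ∈ nbrs p := by
  refine ⟨(m + 1, n), by simp only [Inside]; omega, ?_, by simp [nbrs]⟩
  by_cases hm : m = -1
  · rw [pos_eq_of_D hs (by omega) (by omega) (by omega)]; omega
  · rw [pos_eq_of_E hs (by omega) (by omega) (by omega)]; omega

end Grow

/-- **Spiral configurations grow by one lattice neighbourhood at De Luca–Friesecke's numbers.**  For
`s ≥ 1`, `k ≤ 4`, `(s,k) ≠ (1,0)`: every label of `config (s+1) (k(s+1) + s)` — the hexagon `H_s` and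
the first `k(s+1)+s` labels of ring `s+1` — lies in `config s (ks + s − 1)` or is adjacent to one of
its labels (one step towards the origin, chart by chart along Harborth's traversal).
[cite: LucaFriesecke2017, Theorem 1.1 (b) (p0003)] [cite: Harborth1974, p. 15] -/
theorem exists_adj_of_mem_config {s k : ℕ} (hs : 1 ≤ s) (hk : k ≤ 4) (hsk : ¬ (s = 1 ∧ k = 0))
    {q : ℤ × ℤ} (hq : q ∈ config (s + 1) (k * (s + 1) + s)) :
    q ∈ config s (k * s + s - 1) ∨ ∃ p ∈ config s (k * s + s - 1), Adj p q := by
  have hks : ((k * s + s - 1 : ℕ) : ℤ) = k * s + s - 1 := by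
    rw [Nat.cast_sub (by nlinarith), Nat.cast_add, Nat.cast_mul, Nat.cast_one]
  obtain ⟨m, n⟩ := q
  by_cases hin : Inside (s : ℤ) (m, n)
  · -- `q ∈ H_s`: one step towards `H_{s-1} ⊆ config s _`
    have hq' : (m, n) ∈ hexagon ((s - 1) + 1) := by
      rw [Nat.sub_add_cancel hs, mem_hexagon]; exact hin
    rcases Harborth.exists_adj_of_mem_hexagon_succ hq' with h | ⟨p, hp, hadj⟩
    · left
      rw [mem_config]
      left
      have := mem_hexagon.1 h
      rw [Nat.cast_sub hs] at this
      exact_mod_cast this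
    · right
      refine ⟨p, mem_config.2 (Or.inl ?_), hadj⟩
      have := mem_hexagon.1 hp
      rw [Nat.cast_sub hs] at this
      exact_mod_cast this
  · -- `q` on ring `s + 1` at position `< k(s+1) + s`
    right
    have h2 := mem_config.1 hq
    have e1 : (((s + 1 : ℕ) : ℤ) - 1) = s := by push_cast; ring
    rw [e1] at h2
    rcases h2 with h | ⟨hring, hpos⟩
    · exact absurd h hin
    have hs' : (1 : ℤ) ≤ s := by exact_mod_cast hs
    have hsk' : ¬ ((s : ℤ) = 1 ∧ (k : ℤ) = 0) := by
      rintro ⟨h1, h2⟩; exact hsk ⟨by exact_mod_cast h1, by exact_mod_cast h2⟩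
    have hK : (k : ℤ) = 0 ∧ (k : ℤ) * s = 0 ∨ (k : ℤ) = 1 ∧ (k : ℤ) * s = s ∨
        (k : ℤ) = 2 ∧ (k : ℤ) * s = 2 * s ∨ (k : ℤ) = 3 ∧ (k : ℤ) * s = 3 * s ∨
        (k : ℤ) = 4 ∧ (k : ℤ) * s = 4 * s := by
      interval_cases k <;> simp
    -- the witness, chart by chart
    have key : (∃ p : ℤ × ℤ, Inside (s : ℤ) p ∧ pos (s : ℤ) p < k * s + s - 1 ∧
        (m, n) ∈ HarborthSpiral.nbrs p) → ∃ p ∈ config s (k * s + s - 1), Adj p (m, n) := by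
      rintro ⟨p, hp1, hp2, hp3⟩
      refine ⟨p, mem_config.2 (Or.inr ⟨hp1, ?_⟩), (adj_iff_mem_nbrs _ _).2 hp3⟩
      rw [hks]; exact hp2
    apply key
    simp only [Inside] at hring hin
    push_cast at hring hpos
    have hpos' : pos ((s : ℤ) + 1) (m, n) < (k : ℤ) * s + k + s := by linarith
    generalize hKdef : (k : ℤ) * s = K at hK hpos' ⊢
    simp only [pos] at hpos'
    split_ifs at hpos' with hA hB hC hD hE hF
    · exact grow_A hs' hK hsk' hA hpos'
    · exact grow_B hs' hK hB hpos'
    · exact grow_C hs' hK hC hpos'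
    · exact grow_D hs' hK hD hpos'
    · exact grow_E hs' hK hE hpos'
    · exfalso
      rcases hK with ⟨h1, h2⟩ | ⟨h1, h2⟩ | ⟨h1, h2⟩ | ⟨h1, h2⟩ | ⟨h1, h2⟩ <;> omega
    · exfalso
      clear hK hpos' hKdef key hks hsk' hsk hq
      omega

end HarborthSpiral

namespace HarborthSpiral

/-! ### Units and small facts on labels -/

/-- `rot6` is additive. [cite: HeitmannRadin1980, §2 (p. 283)] -/
theorem rot6_add (a b : ℤ × ℤ) : rot6 (a + b) = rot6 a + rot6 b := by
  obtain ⟨a1, a2⟩ := a; obtain ⟨b1, b2⟩ := b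
  simp only [rot6, Prod.mk_add_mk, Prod.mk.injEq]; constructor <;> ring

/-- Iterates of `rot6` are additive. [cite: HeitmannRadin1980, §2 (p. 283)] -/
theorem rot6_iterate_add (j : ℕ) (a b : ℤ × ℤ) : rot6^[j] (a + b) = rot6^[j] a + rot6^[j] b := by
  induction j generalizing a b with
  | zero => rfl
  | succ j ih => rw [Function.iterate_succ_apply, Function.iterate_succ_apply,
      Function.iterate_succ_apply, rot6_add, ih]

/-- `rot6` preserves the norm form. [cite: HeitmannRadin1980, §2 (p. 283)] -/
theorem normForm_rot6 (q : ℤ × ℤ) : normForm (rot6 q) = normForm q := by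
  obtain ⟨m, n⟩ := q; simp only [rot6, normForm]; ring

/-- `rot6` preserves adjacency. [cite: HeitmannRadin1980, §2 (p. 283)] -/
theorem adj_rot6_iff (p q : ℤ × ℤ) : Adj (rot6 p) (rot6 q) ↔ Adj p q := by
  unfold Adj
  rw [show rot6 q - rot6 p = rot6 (q - p) by
    obtain ⟨a, b⟩ := p; obtain ⟨c, d⟩ := q
    simp only [rot6, Prod.mk_sub_mk, Prod.mk.injEq]; constructor <;> ring, normForm_rot6]

/-- Iterated `rot6` preserves adjacency. [cite: HeitmannRadin1980, §2 (p. 283)] -/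
theorem adj_rot6_iterate_iff (j : ℕ) (p q : ℤ × ℤ) : Adj (rot6^[j] p) (rot6^[j] q) ↔ Adj p q := by
  induction j generalizing p q with
  | zero => exact Iff.rfl
  | succ j ih => rw [Function.iterate_succ_apply', Function.iterate_succ_apply', adj_rot6_iff, ih]

/-- The lattice hexagons are invariant under `rot6`. [cite: HeitmannRadin1980, §3 (p. 283)] -/
theorem rot6_mem_hexagon_iff (t : ℕ) (q : ℤ × ℤ) : rot6 q ∈ hexagon t ↔ q ∈ hexagon t := by
  obtain ⟨m, n⟩ := q
  rw [mem_hexagon, mem_hexagon]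
  simp only [rot6, Inside]
  omega

/-- … hence under its iterates. [cite: HeitmannRadin1980, §3 (p. 283)] -/
theorem rot6_iterate_mem_hexagon_iff (j t : ℕ) (q : ℤ × ℤ) : rot6^[j] q ∈ hexagon t ↔ q ∈ hexagon t := by
  induction j generalizing q with
  | zero => exact Iff.rfl
  | succ j ih => rw [Function.iterate_succ_apply', rot6_mem_hexagon_iff, ih]

/-- **The six units**: `Adj p q` iff `q = p + ζ^i` for some `i < 6`, `ζ^i = rot6^[i] (1,0)`.
[cite: HeitmannRadin1980, §2 (p. 283)] -/
theorem adj_iff_exists_rot6 (p q : ℤ × ℤ) : Adj p q ↔ ∃ i : ℕ, i < 6 ∧ q = p + rot6^[i] (1, 0) := by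
  obtain ⟨a, b⟩ := p; obtain ⟨c, d⟩ := q
  rw [Adj, Prod.mk_sub_mk, normForm_eq_one_iff]
  constructor
  · rintro (⟨h1, h2⟩ | ⟨h1, h2⟩ | ⟨h1, h2⟩ | ⟨h1, h2⟩ | ⟨h1, h2⟩ | ⟨h1, h2⟩)
    · exact ⟨0, by norm_num, by simp; omega⟩
    · exact ⟨3, by norm_num, by simp [rot6]; omega⟩
    · exact ⟨1, by norm_num, by simp [rot6]; omega⟩
    · exact ⟨4, by norm_num, by simp [rot6]; omega⟩
    · exact ⟨5, by norm_num, by simp [rot6]; omega⟩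
    · exact ⟨2, by norm_num, by simp [rot6]; omega⟩
  · rintro ⟨i, hi, h⟩
    interval_cases i
    · simp at h; omega
    all_goals simp [rot6] at h; omega

/-- Adjacent units are consecutive powers of `ζ`. [cite: HeitmannRadin1980, §2 (p. 283)] -/
theorem adj_rot6_iterate_one_iff :
    ∀ a b : Fin 6, Adj (rot6^[a.val] (1, 0)) (rot6^[b.val] (1, 0)) ↔ (b = a + 1 ∨ a = b + 1) := by
  decide

end HarborthSpiral

namespace Harborth

open HarborthSpiral (rot6 rot6inv config hexagon Inside pos Adj normForm)
open Literature.Topology.PlaneTopology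

variable {P : Finset ℂ}

/-! ## §2 Rotating the frame -/

/-- `Φ_{t,u}(ζ·q) = Φ_{t,uζ}(q)`: rotating labels is rotating the frame. [cite: HeitmannRadin1980, §2 (p. 283)] -/
theorem framePt_rot6 (t u : ℂ) (q : ℤ × ℤ) :
    framePt t u (rot6 q) = framePt t (u * Complex.exp (((π / 3 : ℝ) : ℂ) * I)) q := by
  obtain ⟨m, n⟩ := q
  simp only [framePt, rot6, Int.cast_neg, Int.cast_add]
  have h := exp_pi_div_three_mul_I_sq
  linear_combination (-(u * (n : ℂ))) * h

/-- Iterated: `Φ_{t,u}(ζ^j q) = Φ_{t,uζ^j}(q)`. [cite: HeitmannRadin1980, §2 (p. 283)] -/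
theorem framePt_rot6_iterate (t u : ℂ) (j : ℕ) (q : ℤ × ℤ) :
    framePt t u (rot6^[j] q) = framePt t (u * Complex.exp (((π / 3 : ℝ) : ℂ) * I) ^ j) q := by
  induction j generalizing u q with
  | zero => simp
  | succ j ih =>
    rw [Function.iterate_succ_apply, ih, framePt_rot6, pow_succ, mul_assoc]

/-- A frame and its rotations by `ζ^j` carry the same lattice. [cite: HeitmannRadin1980, §2 (p. 283)] -/
theorem exists_label_rot {t u : ℂ} (hlat : ∀ p ∈ P, ∃ q : ℤ × ℤ, p = framePt t u q) (j : ℕ) :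
    ∀ p ∈ P, ∃ q : ℤ × ℤ, p = framePt t (u * Complex.exp (((π / 3 : ℝ) : ℂ) * I) ^ j) q := by
  intro p hp
  obtain ⟨q, rfl⟩ := hlat p hp
  exact ⟨rot6inv^[j] q, by rw [← framePt_rot6_iterate, HarborthSpiral.rot6_iterate_rot6inv_iterate]⟩

/-- `|u ζ^j| = 1`. [cite: HeitmannRadin1980, §2 (p. 283)] -/
theorem norm_mul_zeta_pow {u : ℂ} (hu : ‖u‖ = 1) (j : ℕ) :
    ‖u * Complex.exp (((π / 3 : ℝ) : ℂ) * I) ^ j‖ = 1 := by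
  rw [norm_mul, norm_pow, norm_exp_pi_div_three_mul_I, one_pow, mul_one, hu]

/-- Translating the configuration inside a rotated frame: the image of `C` under
`q ↦ Φ_{t,u}(ζ^j q + c)` is its image under `q ↦ Φ_{t,uζ^j}(q + ζ^{-j}c)`. [cite: HeitmannRadin1980, §2 (p. 283)] -/
theorem image_framePt_rot6_iterate (t u : ℂ) (j : ℕ) (c : ℤ × ℤ) (C : Finset (ℤ × ℤ)) :
    C.image (fun q => framePt t u (rot6^[j] q + c)) =
      C.image (fun q => framePt t (u * Complex.exp (((π / 3 : ℝ) : ℂ) * I) ^ j) (q + rot6inv^[j] c)) := by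
  refine Finset.image_congr fun q _ => ?_
  rw [← framePt_rot6_iterate, HarborthSpiral.rot6_iterate_add, HarborthSpiral.rot6_iterate_rot6inv_iterate]

/-! ## §3 The label set of a configuration in a frame; darts and `adjCount` -/

/-- Pulling a configuration back to labels: if every centre is a frame point, `P` is the image of a
label set of the same cardinality whose ordered adjacent pairs are the darts of `P`.
[cite: HeitmannRadin1980, §2 (p. 283)] -/
theorem exists_labelSet {t u : ℂ} (hu : ‖u‖ = 1) (hlat : ∀ p ∈ P, ∃ q : ℤ × ℤ, p = framePt t u q) :
    ∃ S : Finset (ℤ × ℤ), P = S.image (framePt t u) ∧ S.card = P.card ∧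
      (darts P).card = HarborthSpiral.adjCount S := by
  classical
  have hinj := framePt_injective (t := t) hu
  refine ⟨P.preimage (framePt t u) hinj.injOn, ?_, ?_, ?_⟩
  · ext x
    simp only [Finset.mem_image, Finset.mem_preimage]
    constructor
    · intro hx
      obtain ⟨q, rfl⟩ := hlat x hx
      exact ⟨q, hx, rfl⟩
    · rintro ⟨q, hq, rfl⟩; exact hq
  · have himg : (P.preimage (framePt t u) hinj.injOn).image (framePt t u) = P := by
      rw [Finset.image_preimage]
      refine Finset.filter_true_of_mem fun x hx => ?_
      obtain ⟨q, rfl⟩ := hlat x hx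
      exact ⟨q, rfl⟩
    conv_rhs => rw [← himg]
    rw [Finset.card_image_of_injective _ hinj]
  · -- darts ↔ ordered adjacent label pairs
    set S := P.preimage (framePt t u) hinj.injOn with hS
    unfold HarborthSpiral.adjCount
    rw [card_darts_eq_sum]
    have himg : S.image (framePt t u) = P := by
      rw [hS, Finset.image_preimage]
      refine Finset.filter_true_of_mem fun x hx => ?_
      obtain ⟨q, rfl⟩ := hlat x hx
      exact ⟨q, rfl⟩
    have hsum := Finset.sum_image (f := fun v => (nbrs P v).card) (s := S) (g := framePt t u)
      fun a _ b _ h => hinj h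
    rw [himg] at hsum
    rw [hsum]
    refine Finset.sum_congr rfl fun q hq => ?_
    have hn : nbrs P (framePt t u q) = (S.filter (Adj q)).image (framePt t u) := by
      ext x
      rw [mem_nbrs, Finset.mem_image]
      constructor
      · rintro ⟨hx, h1⟩
        obtain ⟨q', rfl⟩ := hlat x hx
        refine ⟨q', Finset.mem_filter.2 ⟨?_, (norm_framePt_sub_eq_one_iff hu q q').1 h1⟩, rfl⟩
        rw [hS, Finset.mem_preimage]; exact hx
      · rintro ⟨q', hq', rfl⟩
        rw [Finset.mem_filter] at hq'
        refine ⟨?_, (norm_framePt_sub_eq_one_iff hu q q').2 hq'.2⟩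
        have := hq'.1
        rw [hS, Finset.mem_preimage] at this
        exact this
    rw [hn, Finset.card_image_of_injective _ hinj]

/-! ## §4 The particle numbers `N(s,k) = 3s² + 3s + 1 + (s+1)k + s` and their Harborth arithmetic -/

/-- De Luca–Friesecke's type-(b) particle numbers `N(s,k) = 3s² + 3s + 1 + (s+1)k + s`
(`= #config (s+1) ((k+1)(s+1) − 1)`). [cite: LucaFriesecke2017, Theorem 1.1 (b) (p0003)] -/
def typeB (s k : ℕ) : ℕ := 3 * s ^ 2 + 3 * s + 1 + (s + 1) * k + s

/-- `#config (s+1) (k(s+1)+s) = N(s,k)` (`k ≤ 5`). [cite: Harborth1974, p. 15] -/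
theorem card_config_typeB (s k : ℕ) (hk : k ≤ 5) :
    (config (s + 1) (k * (s + 1) + s)).card = typeB s k := by
  have h := (HarborthSpiral.card_config (r := s + 1) (a := k * (s + 1) + s) (by omega) (by nlinarith)).1
  have : ((config (s + 1) (k * (s + 1) + s)).card : ℤ) = (typeB s k : ℤ) := by
    rw [h, typeB]; push_cast; ring
  exact_mod_cast this

/-- `⌈√(12N(s,k) − 3)⌉ = 6s + 4 + k` for `k ≤ 4`, `(s,k) ≠ (0,0)`:
`(6s+3+k)² < 12N − 3 = (6s+3+k)² + 12s + 6k − k² ≤ (6s+4+k)²`. [cite: HeitmannRadin1980, Theorem (2)(b)] -/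
theorem ceil_sqrt_typeB (s k : ℕ) (hk : k ≤ 4) (h0 : ¬ (s = 0 ∧ k = 0)) :
    ⌈Real.sqrt (12 * ((typeB s k : ℕ) : ℝ) - 3)⌉ = 6 * (s : ℤ) + 4 + k := by
  have hk' : (k : ℝ) ≤ 4 := by exact_mod_cast hk
  have hs0 : (0 : ℝ) ≤ s := Nat.cast_nonneg s
  have hk0 : (0 : ℝ) ≤ k := Nat.cast_nonneg k
  have hpos : (1 : ℝ) ≤ s ∨ (1 : ℝ) ≤ k := by
    rcases Nat.eq_zero_or_pos s with hs | hs
    · right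
      have : k ≠ 0 := fun hk0 => h0 ⟨hs, hk0⟩
      exact_mod_cast Nat.one_le_iff_ne_zero.2 this
    · left; exact_mod_cast hs
  have hN : (12 * ((typeB s k : ℕ) : ℝ) - 3) =
      (6 * s + 3 + k) ^ 2 + (12 * s + 6 * k - k ^ 2) := by
    simp only [typeB]; push_cast; ring
  rw [Int.ceil_eq_iff]
  constructor
  · push_cast
    have : (6 * (s : ℝ) + 4 + k - 1) = 6 * s + 3 + k := by ring
    rw [this, Real.lt_sqrt (by positivity), hN]
    rcases hpos with h | h <;> nlinarith
  · push_cast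
    rw [Real.sqrt_le_left (by positivity), hN]
    nlinarith

/-- Harborth's number at `N(s,k)`: `[3N − √(12N−3)] = 3N − (6s + 4 + k)`.
[cite: HeitmannRadin1980, Theorem (1)] -/
theorem harborthNumber_typeB (s k : ℕ) (hk : k ≤ 4) (h0 : ¬ (s = 0 ∧ k = 0)) :
    harborthNumber (typeB s k) = 3 * (typeB s k : ℤ) - (6 * s + 4 + k) := by
  rw [harborthNumber_eq_sub_ceil, ceil_sqrt_typeB s k hk h0]

/-- Peeling arithmetic: `N(s+1,k) − (6s + 7 + k) = N(s,k)`. [cite: LucaFriesecke2017, Theorem 1.1 (b) (p0003)] -/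
theorem typeB_succ_sub (s k : ℕ) : (typeB (s + 1) k : ℤ) - (6 * s + 7 + k) = typeB s k := by
  simp only [typeB]; push_cast; ring

/-! ## §5 The special case `N = 8`: the hexagon `H₁` and one tooth -/

/-- A label adjacent to a label of `H₁` lies in `H₂`. [cite: HeitmannRadin1980, §3 (p. 283)] -/
theorem mem_hexagon_two_of_adj {p q : ℤ × ℤ} (hp : p ∈ hexagon 1) (h : Adj p q) : q ∈ hexagon 2 := by
  obtain ⟨a, b⟩ := p; obtain ⟨c, d⟩ := q
  rw [HarborthSpiral.mem_hexagon] at hp ⊢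
  rw [HarborthSpiral.adj_iff_mem_nbrs] at h
  simp only [HarborthSpiral.Inside] at hp ⊢
  simp only [HarborthSpiral.nbrs, Finset.mem_insert, Finset.mem_singleton, Prod.mk.injEq] at h
  omega

/-- **A label outside `H₁` touching at least two labels of `H₁` is the midpoint of a side of ring `2`**,
i.e. `ζ^j (−1, 2)` for some `j < 6` (the corners of ring `2` touch only one label of `H₁`).
[cite: LucaFriesecke2017, Theorem 1.1 (b) (p0003) (`N = 8`)] -/
theorem eq_rot6_of_two_le_card {q : ℤ × ℤ} (hq2 : q ∈ hexagon 2) (hq1 : q ∉ hexagon 1)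
    (h : 2 ≤ ((hexagon 1).filter fun p => Adj p q).card) :
    ∃ j : Fin 6, q = rot6^[j.val] (-1, 2) := by
  revert hq1 h
  revert q
  decide

/-- `config 2 1 = H₁ ∪ {(−1, 2)}`. [cite: Harborth1974, p. 15] -/
theorem config_two_one : config 2 1 = insert ((-1 : ℤ), (2 : ℤ)) (hexagon 1) := by
  rw [show (1 : ℕ) = 0 + 1 from rfl, HarborthSpiral.config_succ (by norm_num) (by norm_num),
    HarborthSpiral.config_zero (by norm_num)]
  simp [HarborthSpiral.ringPoint]

/-- `(0,0) + c = c` in `ℤ × ℤ`. [folklore] -/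
private theorem zero_pair_add (c : ℤ × ℤ) : ((0 : ℤ), (0 : ℤ)) + c = c :=
  Prod.ext (by simp) (by simp)

/-- **The case `N = 8`.**  A maximal configuration of `8` unit discs lying in a frame is a rotated
copy of `config 2 1` — the hexagon `H₁` together with one disc touching two of its discs: peeling the
`7` boundary discs leaves one interior disc, whose six lattice neighbours are present; the eighth disc
touches at least two of the seven (a maximal configuration does not split), so it is the midpoint of a
side of ring `2`. [cite: LucaFriesecke2017, Theorem 1.1 (b) (p0003) (`s = 1`, `k = 0`)]
[cite: HeitmannRadin1980, Theorem (2)(a)–(b) p. 284] -/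
theorem eq_image_config_eight (hP : IsHard P) (hcard : P.card = 8)
    (hmax : 2 * harborthNumber P.card ≤ ((darts P).card : ℤ)) {t u : ℂ} (hu : ‖u‖ = 1)
    (hlat : ∀ p ∈ P, ∃ q : ℤ × ℤ, p = framePt t u q) :
    ∃ (j : ℕ) (c : ℤ × ℤ), P = (config 2 1).image fun q =>
      framePt t (u * Complex.exp (((π / 3 : ℝ) : ℂ) * I) ^ j) (q + c) := by
  classical
  have h3 : 3 ≤ P.card := by omega
  have hns : ¬ Splits P := not_splits_of_maximal hP hmax
  have hne : P.Nonempty := Finset.card_pos.1 (by omega)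
  have h2 : ∀ p ∈ P, 2 ≤ (nbrs P p).card := fun p hp => two_le_card_nbrs_of_not_splits h3 hns hp
  have ht := tight_or_outer_of_maximal P.card P hP rfl h3 hmax hne h2
  set S := bdrySet P hne h2 with hS
  have hSP : S ⊆ P := bdrySet_subset
  have hScard : (S.card : ℤ) = 7 := by
    have h := card_bdrySet_of_maximal (hne := hne) (h2 := h2) hP h3 hmax
    have h8 : P.card = typeB 1 0 := by rw [hcard]; norm_num [typeB]
    rw [← hS, h8, ceil_sqrt_typeB 1 0 (by norm_num) (by omega)] at h
    push_cast at h
    linarith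
  have haP : S.card ≤ P.card := Finset.card_le_card hSP
  have hc1 : (P \ S).card = 1 := by
    have := Finset.card_sdiff_of_subset hSP
    omega
  obtain ⟨v, hv⟩ := Finset.card_eq_one.1 hc1
  have hvP' : v ∈ P \ S := by rw [hv]; exact Finset.mem_singleton_self v
  have hvP : v ∈ P := Finset.sdiff_subset hvP'
  obtain ⟨c, hvc⟩ := hlat v hvP
  have h6v : (nbrs P (framePt t u c)).card = 6 := by
    rw [← hvc]
    exact card_nbrs_eq_six_of_tight (hne := hne) (h2 := h2) hP ht hvP (Finset.mem_sdiff.1 hvP').2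
  -- `Φ(H₁ + c) ⊆ P`
  have hhex : (hexagon 1).image (fun q => framePt t u (q + c)) ⊆ P := by
    intro x hx
    obtain ⟨q, hq, rfl⟩ := Finset.mem_image.1 hx
    rcases exists_adj_of_mem_hexagon_succ (k := 0) hq with hq0 | ⟨p, hp, hadj⟩
    · rw [HarborthSpiral.hexagon_zero, Finset.mem_singleton] at hq0
      subst hq0
      rw [zero_pair_add, ← hvc]; exact hvP
    · rw [HarborthSpiral.hexagon_zero, Finset.mem_singleton] at hp
      subst hp
      have hadj' : Adj c (q + c) := by
        have := (adj_add_right_iff (0, 0) q c).2 hadj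
        rwa [zero_pair_add] at this
      exact framePt_mem_of_card_nbrs_eq_six hu hlat (by rw [← hvc]; exact hvP) h6v hadj'
  -- the eighth disc
  have hinj : Function.Injective fun q : ℤ × ℤ => framePt t u (q + c) :=
    (framePt_injective (t := t) hu).comp (add_left_injective c)
  have hcard7 : ((hexagon 1).image fun q => framePt t u (q + c)).card = 7 := by
    rw [Finset.card_image_of_injective _ hinj, (HarborthSpiral.count_hexagon 1).1]; norm_num
  obtain ⟨x, hxP, hxnot⟩ : ∃ x ∈ P, x ∉ (hexagon 1).image fun q => framePt t u (q + c) := by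
    by_contra hcon
    push Not at hcon
    have := Finset.card_le_card (show P ⊆ _ from hcon)
    omega
  obtain ⟨qx, hqx⟩ := hlat x hxP
  have hPeq : P = insert x ((hexagon 1).image fun q => framePt t u (q + c)) := by
    symm
    apply Finset.eq_of_subset_of_card_le (Finset.insert_subset hxP hhex)
    rw [Finset.card_insert_of_notMem hxnot, hcard7, hcard]
  -- `x` touches at least two discs, all of them in `Φ(H₁ + c)`
  have hxn : 2 ≤ ((hexagon 1).filter fun p => Adj p (qx - c)).card := by
    have hsub : nbrs P x ⊆ ((hexagon 1).filter fun p => Adj p (qx - c)).image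
        fun q => framePt t u (q + c) := by
      intro w hw
      obtain ⟨hwP, hw1⟩ := mem_nbrs.1 hw
      have hwx : w ≠ x := by
        intro h; rw [h, sub_self, norm_zero] at hw1; exact zero_ne_one hw1
      rw [hPeq, Finset.mem_insert] at hwP
      rcases hwP with h | h
      · exact absurd h hwx
      obtain ⟨q, hq, rfl⟩ := Finset.mem_image.1 h
      refine Finset.mem_image.2 ⟨q, Finset.mem_filter.2 ⟨hq, ?_⟩, rfl⟩
      have : Adj (q + c) qx := by
        rw [hqx, norm_sub_rev] at hw1
        exact (norm_framePt_sub_eq_one_iff hu (q + c) qx).1 hw1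
      have e : qx = (qx - c) + c := by rw [sub_add_cancel]
      rw [e] at this
      exact (adj_add_right_iff q (qx - c) c).1 this
    exact (h2 x hxP).trans ((Finset.card_le_card hsub).trans Finset.card_image_le)
  have hq2 : qx - c ∈ hexagon 2 := by
    obtain ⟨p, hp⟩ : ((hexagon 1).filter fun p => Adj p (qx - c)).Nonempty :=
      Finset.card_pos.1 (by omega)
    exact mem_hexagon_two_of_adj (Finset.mem_filter.1 hp).1 (Finset.mem_filter.1 hp).2
  have hq1 : qx - c ∉ hexagon 1 := by
    intro h
    apply hxnot
    exact Finset.mem_image.2 ⟨qx - c, h, by rw [sub_add_cancel, hqx]⟩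
  obtain ⟨j, hj⟩ := eq_rot6_of_two_le_card hq2 hq1 hxn
  -- assemble: `P = Φ_{t,u}(ζ^j · config 2 1 + c) = Φ_{t,uζ^j}(config 2 1 + ζ^{-j} c)`
  refine ⟨j.val, rot6inv^[j.val] c, ?_⟩
  rw [← image_framePt_rot6_iterate, config_two_one, Finset.image_insert, hPeq]
  congr 1
  · rw [← hj, sub_add_cancel, hqx]
  · ext y
    simp only [Finset.mem_image]
    constructor
    · rintro ⟨q, hq, rfl⟩
      exact ⟨rot6inv^[j.val] q,
        (HarborthSpiral.rot6_iterate_mem_hexagon_iff j.val 1 _).1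
          (by rw [HarborthSpiral.rot6_iterate_rot6inv_iterate]; exact hq),
        by rw [HarborthSpiral.rot6_iterate_rot6inv_iterate]⟩
    · rintro ⟨q, hq, rfl⟩
      exact ⟨rot6^[j.val] q, (HarborthSpiral.rot6_iterate_mem_hexagon_iff j.val 1 q).2 hq, rfl⟩

/-! ## §6 The induction -/

set_option maxHeartbeats 400000 in
/-- **The peeling induction** (module docstring).  Assume the base property for `k ≤ 4` — every
maximal configuration of `k + 1` discs lying in a frame is a rotated copy of `config 1 k` (a disc with
`k` consecutive neighbours).  Then for every `s`, every maximal configuration of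
`N(s,k) = 3s²+3s+1+(s+1)k+s` discs lying in a frame `t + u(ℤ + ℤζ)` is
`Φ_{t,uζ^j}(config (s+1) (k(s+1)+s) + c)` for some `j`, `c`: the interior (peel the `6s+1+k`
boundary discs) is maximal with `N(s−1,k)` discs, hence a spiral configuration by induction, and
the six lattice neighbours of each interior disc fill `config (s+1) (k(s+1)+s)`
(`exists_adj_of_mem_config`); the case `(s,k) = (1,0)` is `eq_image_config_eight`.
[cite: LucaFriesecke2017, Theorem 1.1 (b) (p0003)] [cite: HeitmannRadin1980, Theorem (2)(a)–(b) p. 284] -/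
theorem eq_image_config_of_frame (k : ℕ) (hk : k ≤ 4)
    (hbase : ∀ (P : Finset ℂ), IsHard P → P.card = k + 1 →
      2 * harborthNumber P.card ≤ ((darts P).card : ℤ) → ∀ t u : ℂ, ‖u‖ = 1 →
      (∀ p ∈ P, ∃ q : ℤ × ℤ, p = framePt t u q) →
      ∃ (j : ℕ) (c : ℤ × ℤ), P = (config 1 k).image fun q =>
        framePt t (u * Complex.exp (((π / 3 : ℝ) : ℂ) * I) ^ j) (q + c)) :
    ∀ (s : ℕ) (P : Finset ℂ), IsHard P → P.card = typeB s k →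
      2 * harborthNumber P.card ≤ ((darts P).card : ℤ) → ∀ t u : ℂ, ‖u‖ = 1 →
      (∀ p ∈ P, ∃ q : ℤ × ℤ, p = framePt t u q) →
      ∃ (j : ℕ) (c : ℤ × ℤ), P = (config (s + 1) (k * (s + 1) + s)).image fun q =>
        framePt t (u * Complex.exp (((π / 3 : ℝ) : ℂ) * I) ^ j) (q + c) := by
  set ζ := Complex.exp (((π / 3 : ℝ) : ℂ) * I) with hζ
  intro s
  induction s with
  | zero =>
    intro P hP hcard hmax t u hu hlat
    have hc : P.card = k + 1 := by rw [hcard, typeB]; ring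
    simpa using hbase P hP hc hmax t u hu hlat
  | succ s ih =>
    intro P hP hcard hmax t u hu hlat
    classical
    by_cases h10 : s = 0 ∧ k = 0
    · -- `N = 8`
      obtain ⟨rfl, rfl⟩ := h10
      have h8 : P.card = 8 := by rw [hcard]; norm_num [typeB]
      have e2 : config (0 + 1 + 1) (0 * (0 + 1 + 1) + (0 + 1)) = config 2 1 := by norm_num
      rw [e2]
      exact eq_image_config_eight hP h8 hmax hu hlat
    -- sizes
    have hN8 : 8 ≤ typeB (s + 1) k := by unfold typeB; nlinarith
    have h3 : 3 ≤ P.card := by rw [hcard]; omega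
    have hns : ¬ Splits P := not_splits_of_maximal hP hmax
    have hne : P.Nonempty := Finset.card_pos.1 (by omega)
    have h2 : ∀ p ∈ P, 2 ≤ (nbrs P p).card := fun p hp => two_le_card_nbrs_of_not_splits h3 hns hp
    have ht := tight_or_outer_of_maximal P.card P hP rfl h3 hmax hne h2
    set S := bdrySet P hne h2 with hS
    have hSP : S ⊆ P := bdrySet_subset
    -- `a = 6s + 7 + k`
    have hScard : (S.card : ℤ) = 6 * s + 7 + k := by
      have h := card_bdrySet_of_maximal (hne := hne) (h2 := h2) hP h3 hmax
      rw [← hS, hcard, ceil_sqrt_typeB (s + 1) k hk (by omega)] at h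
      push_cast at h
      linarith
    -- bookkeeping
    obtain ⟨-, haP, -, hbook, hDS, -, -, -, hcardP'⟩ :=
      boundary_bookkeeping (hne := hne) (h2 := h2) hP hns
    rw [← hS] at haP hbook hDS hcardP'
    have hσ := sum_card_nbrs_bdrySet_eq_of_tight (hne := hne) (h2 := h2) hP hns ht
    rw [← hS] at hσ
    have hcardP'2 : (P \ S).card = typeB s k := by
      have h1 : ((P \ S).card : ℤ) = P.card - S.card := by rw [hcardP', Nat.cast_sub haP]
      have h2' : ((P \ S).card : ℤ) = (typeB s k : ℤ) := by
        rw [h1, hcard, hScard, ← typeB_succ_sub s k]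
      exact_mod_cast h2'
    have hP' : IsHard (P \ S) := hP.mono Finset.sdiff_subset
    have hlat' : ∀ p ∈ P \ S, ∃ q : ℤ × ℤ, p = framePt t u q := fun p hp =>
      hlat p (Finset.sdiff_subset hp)
    -- interior discs touch six others
    have h6 : ∀ v ∈ P \ S, (nbrs P v).card = 6 := fun v hv =>
      card_nbrs_eq_six_of_tight (hne := hne) (h2 := h2) hP ht (Finset.mem_sdiff.1 hv).1
        (Finset.mem_sdiff.1 hv).2
    have hsk : ¬ (s + 1 = 1 ∧ k = 0) := by omega
    -- Harborth numbers and maximality of the interior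
    have hBn : harborthNumber P.card = 3 * (typeB (s + 1) k : ℤ) - (6 * (s + 1 : ℕ) + 4 + k) := by
      rw [hcard]; exact harborthNumber_typeB (s + 1) k hk (by omega)
    have hBn' : harborthNumber (P \ S).card = 3 * (typeB s k : ℤ) - (6 * s + 4 + k) := by
      rw [hcardP'2]; exact harborthNumber_typeB s k hk h10
    have hmax' : 2 * harborthNumber (P \ S).card ≤ ((darts (P \ S)).card : ℤ) := by
      rw [hBn']
      rw [hBn] at hmax
      have e := typeB_succ_sub s k
      push_cast at hmax e ⊢
      linarith [hbook, hDS, hσ, hScard, hmax, e]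
    obtain ⟨j, c, hc⟩ := ih (P \ S) hP' hcardP'2 hmax' t u hu hlat'
    -- work in the rotated frame `u' = u ζ^j`
    set u' := u * ζ ^ j with hu'
    have hu'1 : ‖u'‖ = 1 := norm_mul_zeta_pow hu j
    have hlatP : ∀ p ∈ P, ∃ q : ℤ × ℤ, p = framePt t u' q := exists_label_rot hlat j
    have ea : k * (s + 1) + (s + 1) - 1 = k * (s + 1) + s := by omega
    -- the bigger spiral configuration lies in `P`
    have hgrow : (config (s + 1 + 1) (k * (s + 1 + 1) + (s + 1))).image
        (fun q => framePt t u' (q + c)) ⊆ P := by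
      intro x hx
      obtain ⟨q, hq, rfl⟩ := Finset.mem_image.1 hx
      rcases HarborthSpiral.exists_adj_of_mem_config (s := s + 1) (k := k) (by omega) hk hsk hq
        with hq'' | ⟨p, hp, hadj⟩
      · rw [ea] at hq''
        have hmem : framePt t u' (q + c) ∈ P \ S := by rw [hc]; exact Finset.mem_image_of_mem _ hq''
        exact Finset.sdiff_subset hmem
      · rw [ea] at hp
        have hpP' : framePt t u' (p + c) ∈ P \ S := by rw [hc]; exact Finset.mem_image_of_mem _ hp
        exact framePt_mem_of_card_nbrs_eq_six hu'1 hlatP (Finset.sdiff_subset hpP') (h6 _ hpP')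
          ((adj_add_right_iff p q c).2 hadj)
    have hinj : Function.Injective fun q : ℤ × ℤ => framePt t u' (q + c) :=
      (framePt_injective (t := t) hu'1).comp (add_left_injective c)
    have hcardimg : ((config (s + 1 + 1) (k * (s + 1 + 1) + (s + 1))).image
        fun q => framePt t u' (q + c)).card = P.card := by
      rw [Finset.card_image_of_injective _ hinj, card_config_typeB (s + 1) k (by omega), hcard]
    exact ⟨j, c, (Finset.eq_of_subset_of_card_le hgrow hcardimg.ge).symm⟩

/-! ## §7 The base cases `k = 0, 1, 2` (`N = 1, 2, 3`) -/

/-- `config 1 0 = {0}`. [cite: Harborth1974, p. 15] -/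
theorem config_one_zero : config 1 0 = {((0 : ℤ), (0 : ℤ))} := by
  rw [HarborthSpiral.config_zero (by norm_num), Nat.sub_self, HarborthSpiral.hexagon_zero]

/-- `config 1 1 = {(0,1), 0}`. [cite: Harborth1974, p. 15] -/
theorem config_one_one : config 1 1 = {((0 : ℤ), (1 : ℤ)), ((0 : ℤ), (0 : ℤ))} := by
  rw [show (1 : ℕ) = 0 + 1 from rfl, HarborthSpiral.config_succ (by norm_num) (by norm_num),
    config_one_zero]
  simp [HarborthSpiral.ringPoint]

/-- `config 1 2 = {(1,0), (0,1), 0}`. [cite: Harborth1974, p. 15] -/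
theorem config_one_two :
    config 1 2 = {((1 : ℤ), (0 : ℤ)), ((0 : ℤ), (1 : ℤ)), ((0 : ℤ), (0 : ℤ))} := by
  rw [show (2 : ℕ) = 1 + 1 from rfl, HarborthSpiral.config_succ (by norm_num) (by norm_num),
    config_one_one]
  simp [HarborthSpiral.ringPoint]

/-- `ζ^j · 0 = 0` on labels. [cite: HeitmannRadin1980, §2 (p. 283)] -/
theorem rot6_iterate_zero (j : ℕ) : rot6^[j] ((0 : ℤ), (0 : ℤ)) = (0, 0) := by
  induction j with
  | zero => rfl
  | succ j ih => rw [Function.iterate_succ_apply', ih]; rfl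

/-- Harborth's number of two discs is one contact. [cite: Harborth1974, p. 14 (`B(2) = 1`)] -/
theorem harborthNumber_two : harborthNumber 2 = 1 := by
  rw [show (2 : ℕ) = typeB 0 1 by norm_num [typeB], harborthNumber_typeB 0 1 (by norm_num) (by omega)]
  norm_num [typeB]

/-- Harborth's number of three discs is three contacts. [cite: Harborth1974, p. 14] -/
theorem harborthNumber_three : harborthNumber 3 = 3 := by
  rw [show (3 : ℕ) = typeB 0 2 by norm_num [typeB], harborthNumber_typeB 0 2 (by norm_num) (by omega)]
  norm_num [typeB]

/-- **Base case `k = 0`** (`N = 1`): a single disc is `Φ(config 1 0 + c)`.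
[cite: LucaFriesecke2017, Theorem 1.1 (b) (p0003)] -/
theorem base_zero (P : Finset ℂ) (_hP : IsHard P) (hcard : P.card = 0 + 1)
    (_hmax : 2 * harborthNumber P.card ≤ ((darts P).card : ℤ)) (t u : ℂ) (_hu : ‖u‖ = 1)
    (hlat : ∀ p ∈ P, ∃ q : ℤ × ℤ, p = framePt t u q) :
    ∃ (j : ℕ) (c : ℤ × ℤ), P = (config 1 0).image fun q =>
      framePt t (u * Complex.exp (((π / 3 : ℝ) : ℂ) * I) ^ j) (q + c) := by
  obtain ⟨p, rfl⟩ := Finset.card_eq_one.1 hcard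
  obtain ⟨c, hc⟩ := hlat p (Finset.mem_singleton_self p)
  refine ⟨0, c, ?_⟩
  rw [config_one_zero, Finset.image_singleton, zero_pair_add, pow_zero, mul_one, hc]

/-- **Base case `k = 1`** (`N = 2`): two touching discs are `Φ(config 1 1 + c)` in a suitably rotated
frame. [cite: LucaFriesecke2017, Theorem 1.1 (b) (p0003)] -/
theorem base_one (P : Finset ℂ) (_hP : IsHard P) (hcard : P.card = 1 + 1)
    (hmax : 2 * harborthNumber P.card ≤ ((darts P).card : ℤ)) (t u : ℂ) (hu : ‖u‖ = 1)
    (hlat : ∀ p ∈ P, ∃ q : ℤ × ℤ, p = framePt t u q) :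
    ∃ (j : ℕ) (c : ℤ × ℤ), P = (config 1 1).image fun q =>
      framePt t (u * Complex.exp (((π / 3 : ℝ) : ℂ) * I) ^ j) (q + c) := by
  classical
  rw [hcard, harborthNumber_two] at hmax
  obtain ⟨d, hd⟩ : (darts P).Nonempty := Finset.card_pos.1 (by omega)
  obtain ⟨⟨hx, hy⟩, hd1⟩ := mem_darts.1 hd
  have hxy : d.1 ≠ d.2 := ne_of_mem_darts hd
  have hPeq : P = {d.1, d.2} := by
    symm
    apply Finset.eq_of_subset_of_card_le
    · intro z hz
      rcases Finset.mem_insert.1 hz with rfl | hz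
      · exact hx
      · rw [Finset.mem_singleton.1 hz]; exact hy
    · rw [Finset.card_pair hxy, hcard]
  obtain ⟨qx, hqx⟩ := hlat _ hx
  obtain ⟨qy, hqy⟩ := hlat _ hy
  have hadj : Adj qx qy := by
    rw [hqx, hqy] at hd1
    exact (norm_framePt_sub_eq_one_iff hu qx qy).1 hd1
  obtain ⟨i, hi, hqy'⟩ := (HarborthSpiral.adj_iff_exists_rot6 qx qy).1 hadj
  have key : ∀ i : ℕ, i < 6 → ∃ j : ℕ, j < 6 ∧ rot6^[j] ((0 : ℤ), (1 : ℤ)) = rot6^[i] (1, 0) := by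
    decide
  obtain ⟨j, -, hj⟩ := key i hi
  refine ⟨j, rot6inv^[j] qx, ?_⟩
  rw [← image_framePt_rot6_iterate, config_one_one, Finset.image_insert, Finset.image_singleton,
    hj, rot6_iterate_zero, zero_pair_add, hPeq, hqx, hqy, hqy', add_comm qx, Finset.pair_comm]

/-- **Base case `k = 2`** (`N = 3`): three pairwise touching discs are `Φ(config 1 2 + c)` in a suitably
rotated frame. [cite: LucaFriesecke2017, Theorem 1.1 (b) (p0003)] -/
theorem base_two (P : Finset ℂ) (_hP : IsHard P) (hcard : P.card = 2 + 1)
    (hmax : 2 * harborthNumber P.card ≤ ((darts P).card : ℤ)) (t u : ℂ) (hu : ‖u‖ = 1)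
    (hlat : ∀ p ∈ P, ∃ q : ℤ × ℤ, p = framePt t u q) :
    ∃ (j : ℕ) (c : ℤ × ℤ), P = (config 1 2).image fun q =>
      framePt t (u * Complex.exp (((π / 3 : ℝ) : ℂ) * I) ^ j) (q + c) := by
  classical
  rw [hcard, harborthNumber_three] at hmax
  -- all pairs touch
  have hsub : darts P ⊆ P.offDiag := by
    intro d hd
    rw [Finset.mem_offDiag]
    exact ⟨(mem_darts.1 hd).1.1, (mem_darts.1 hd).1.2, ne_of_mem_darts hd⟩
  have hoff : P.offDiag.card = 6 := by rw [Finset.offDiag_card, hcard]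
  have hall : darts P = P.offDiag :=
    Finset.eq_of_subset_of_card_le hsub (by rw [hoff]; exact_mod_cast hmax)
  have htouch : ∀ a ∈ P, ∀ b ∈ P, a ≠ b → ‖b - a‖ = 1 := by
    intro a ha b hb hab
    have : (a, b) ∈ darts P := by rw [hall, Finset.mem_offDiag]; exact ⟨ha, hb, hab⟩
    exact (mem_darts.1 this).2
  obtain ⟨x, y, z, hxy, hxz, hyz, hPeq⟩ := Finset.card_eq_three.1 hcard
  have hx : x ∈ P := by rw [hPeq]; simp
  have hy : y ∈ P := by rw [hPeq]; simp
  have hz : z ∈ P := by rw [hPeq]; simp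
  obtain ⟨qx, hqx⟩ := hlat x hx
  obtain ⟨qy, hqy⟩ := hlat y hy
  obtain ⟨qz, hqz⟩ := hlat z hz
  have hadj : ∀ {a b : ℂ} {qa qb : ℤ × ℤ}, a ∈ P → b ∈ P → a ≠ b → a = framePt t u qa →
      b = framePt t u qb → Adj qa qb := by
    intro a b qa qb ha hb hab ha' hb'
    have h := htouch a ha b hb hab
    rw [ha', hb'] at h
    exact (norm_framePt_sub_eq_one_iff hu qa qb).1 h
  obtain ⟨a, ha, hqy'⟩ := (HarborthSpiral.adj_iff_exists_rot6 qx qy).1 (hadj hx hy hxy hqx hqy)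
  obtain ⟨b, hb, hqz'⟩ := (HarborthSpiral.adj_iff_exists_rot6 qx qz).1 (hadj hx hz hxz hqx hqz)
  have hyz' : Adj (rot6^[a] ((1 : ℤ), (0 : ℤ))) (rot6^[b] (1, 0)) := by
    have h := hadj hy hz hyz hqy hqz
    rw [hqy', hqz'] at h
    unfold Adj at h ⊢
    rwa [add_sub_add_left_eq_sub] at h
  have hab := (HarborthSpiral.adj_rot6_iterate_one_iff ⟨a, ha⟩ ⟨b, hb⟩).1 hyz'
  have key : ∀ a b : Fin 6, (b = a + 1 ∨ a = b + 1) → ∃ j : ℕ, j < 6 ∧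
      ((rot6^[j] ((1 : ℤ), (0 : ℤ)) = rot6^[a.val] (1, 0) ∧ rot6^[j] ((0 : ℤ), (1 : ℤ)) = rot6^[b.val] (1, 0)) ∨
       (rot6^[j] ((1 : ℤ), (0 : ℤ)) = rot6^[b.val] (1, 0) ∧ rot6^[j] ((0 : ℤ), (1 : ℤ)) = rot6^[a.val] (1, 0))) := by
    decide
  obtain ⟨j, -, hj⟩ := key ⟨a, ha⟩ ⟨b, hb⟩ hab
  refine ⟨j, rot6inv^[j] qx, ?_⟩
  rw [← image_framePt_rot6_iterate, config_one_two, Finset.image_insert, Finset.image_insert,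
    Finset.image_singleton, rot6_iterate_zero, zero_pair_add, hPeq, hqx, hqy, hqz, hqy', hqz']
  rcases hj with ⟨h1, h2⟩ | ⟨h1, h2⟩
  · rw [h1, h2, add_comm qx, add_comm qx]
    -- {Φ(ρᵃe+qx), Φ(ρᵇe+qx), Φ qx} = {Φ qx, Φ(qx... )}: reorder
    ext w; simp only [Finset.mem_insert, Finset.mem_singleton]; tauto
  · rw [h1, h2, add_comm qx, add_comm qx]
    ext w; simp only [Finset.mem_insert, Finset.mem_singleton]; tauto

end Harborth

/-! ## §8 Labels: translation, hubs, and the base cases `k = 3, 4` by enumeration inside `H₂` -/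

namespace HarborthSpiral

/-- Translating a label set does not change its number of ordered adjacent pairs.
[cite: HeitmannRadin1980, §2 (p. 283)] -/
theorem adjCount_image_add (S : Finset (ℤ × ℤ)) (c : ℤ × ℤ) :
    adjCount (S.image fun q => q + c) = adjCount S := by
  classical
  have hinj : Function.Injective fun q : ℤ × ℤ => q + c := add_left_injective c
  unfold adjCount
  rw [Finset.sum_image fun a _ b _ h => hinj h]
  refine Finset.sum_congr rfl fun q _ => ?_
  have : (S.image fun q => q + c).filter (Adj (q + c)) = (S.filter (Adj q)).image fun q => q + c := by
    ext x
    simp only [Finset.mem_filter, Finset.mem_image]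
    constructor
    · rintro ⟨⟨y, hy, rfl⟩, had⟩
      exact ⟨y, ⟨hy, (Harborth.adj_add_right_iff q y c).1 had⟩, rfl⟩
    · rintro ⟨y, ⟨hy, had⟩, rfl⟩
      exact ⟨⟨y, hy, rfl⟩, (Harborth.adj_add_right_iff q y c).2 had⟩
  rw [this, Finset.card_image_of_injective _ hinj]

/-- Translating a label set carries the neighbours of `v` to the neighbours of `v + c`.
[cite: HeitmannRadin1980, §2 (p. 283)] -/
theorem card_filter_adj_image_add (S : Finset (ℤ × ℤ)) (v c : ℤ × ℤ) :
    ((S.image fun q => q + c).filter (Adj (v + c))).card = (S.filter (Adj v)).card := by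
  classical
  have hinj : Function.Injective fun q : ℤ × ℤ => q + c := add_left_injective c
  have : (S.image fun q => q + c).filter (Adj (v + c)) = (S.filter (Adj v)).image fun q => q + c := by
    ext x
    simp only [Finset.mem_filter, Finset.mem_image]
    constructor
    · rintro ⟨⟨y, hy, rfl⟩, had⟩
      exact ⟨y, ⟨hy, (Harborth.adj_add_right_iff v y c).1 had⟩, rfl⟩
    · rintro ⟨y, ⟨hy, had⟩, rfl⟩
      exact ⟨⟨y, hy, rfl⟩, (Harborth.adj_add_right_iff v y c).2 had⟩
  rw [this, Finset.card_image_of_injective _ hinj]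

/-- **A hub.** If `adjCount S > m · #S`, some label has more than `m` neighbours in `S`
(`adjCount` is the sum of the numbers of neighbours). [cite: Harborth1974, p. 14] -/
theorem exists_lt_card_filter_adj {S : Finset (ℤ × ℤ)} {m : ℕ} (h : m * S.card < adjCount S) :
    ∃ v ∈ S, m < (S.filter (Adj v)).card := by
  unfold adjCount at h
  have hc : ∑ _v ∈ S, m = m * S.card := by rw [Finset.sum_const, smul_eq_mul, mul_comm]
  rw [← hc] at h
  exact Finset.exists_lt_of_sum_lt h

/-- `0 ∈ H₁`. [cite: HeitmannRadin1980, §3 (p. 283)] -/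
theorem zero_mem_hexagon_one : (0 : ℤ × ℤ) ∈ hexagon 1 := by decide

/-- The neighbours of `0` lie in `H₁`. [cite: HeitmannRadin1980, §3 (p. 283)] -/
theorem mem_hexagon_one_of_adj_zero {q : ℤ × ℤ} (h : Adj 0 q) : q ∈ hexagon 1 := by
  have hsub : nbrs (0 : ℤ × ℤ) ⊆ hexagon 1 := by decide
  exact hsub ((adj_iff_mem_nbrs _ _).1 h)

/-- A label adjacent to a label of `H₁` lies in `H₂` (label form of `Harborth.mem_hexagon_two_of_adj`).
[cite: HeitmannRadin1980, §3 (p. 283)] -/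
theorem mem_hexagon_two_of_adj' {p q : ℤ × ℤ} (hp : p ∈ hexagon 1) (h : Adj p q) : q ∈ hexagon 2 :=
  Harborth.mem_hexagon_two_of_adj hp h

/-- **Re-centring.** Translating `S` by `−v` (`v ∈ S`) gives a label set containing `0` with the same
cardinality and `adjCount`, in which `0` has as many neighbours as `v` had.
[cite: HeitmannRadin1980, §2 (p. 283)] -/
theorem recentre {S : Finset (ℤ × ℤ)} {v : ℤ × ℤ} (hv : v ∈ S) :
    (0 : ℤ × ℤ) ∈ S.image (fun q => q + -v) ∧ (S.image fun q => q + -v).card = S.card ∧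
      adjCount (S.image fun q => q + -v) = adjCount S ∧
      ((S.image fun q => q + -v).filter (Adj 0)).card = (S.filter (Adj v)).card ∧
      S = (S.image fun q => q + -v).image (fun q => q + v) := by
  classical
  refine ⟨Finset.mem_image.2 ⟨v, hv, add_neg_cancel v⟩,
    Finset.card_image_of_injective _ (add_left_injective (-v)), adjCount_image_add S (-v), ?_, ?_⟩
  · have h := card_filter_adj_image_add S v (-v)
    rwa [add_neg_cancel] at h
  · rw [Finset.image_image]
    symm
    convert Finset.image_id (s := S) using 2
    funext q
    simp

/-- Enumeration (`H₁` has `7` labels): a `4`-subset of `H₁` with `≥ 5` contacts is a rotated translate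
of `config 1 3` (a disc with three consecutive neighbours). [cite: LucaFriesecke2017, Theorem 1.1 (b) (p0003) (`N = 4`)] -/
theorem labels_three_of_subset_hexagon : ∀ U ∈ (hexagon 1).powerset, U.card = 4 → 10 ≤ adjCount U →
    ∃ j : Fin 6, ∃ c ∈ U, U = (config 1 3).image fun q => rot6^[j.val] q + c := by
  decide +kernel

/-- Enumeration: a `4`-subset of `H₁` has at most `5` contacts. [cite: Harborth1974, p. 14 (`B(4) = 5`)] -/
theorem adjCount_le_ten_of_subset_hexagon : ∀ N ∈ (hexagon 1).powerset, N.card = 4 → adjCount N ≤ 10 := by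
  decide +kernel

/-- Enumeration: a `5`-subset of `H₁` with `≥ 7` contacts is a rotated translate of `config 1 4`
(the trapezoid). [cite: LucaFriesecke2017, Theorem 1.1 (b) (p0003) (`N = 5`)] -/
theorem labels_four_of_subset_hexagon : ∀ U ∈ (hexagon 1).powerset, U.card = 5 → 14 ≤ adjCount U →
    ∃ j : Fin 6, ∃ c ∈ U, U = (config 1 4).image fun q => rot6^[j.val] q + c := by
  decide +kernel

/-- Enumeration: a `4`-subset of `H₁` together with a label of ring `2`, with `≥ 7` contacts in total, is
a rotated translate of `config 1 4`. [cite: LucaFriesecke2017, Theorem 1.1 (b) (p0003) (`N = 5`)] -/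
theorem labels_four_of_insert : ∀ N ∈ (hexagon 1).powerset, N.card = 4 →
    ∀ w ∈ hexagon 2, w ∉ hexagon 1 → 14 ≤ adjCount (insert w N) →
    ∃ j : Fin 6, ∃ c ∈ insert w N, insert w N = (config 1 4).image fun q => rot6^[j.val] q + c := by
  decide +kernel

/-- **Labels, `N = 4`.** Four labels with `≥ 5` contacts are a rotated translate of `config 1 3`: a
label with three neighbours exists (`10 > 2·4`), all others are its neighbours, so the set lies in a
translate of `H₁`. [cite: LucaFriesecke2017, Theorem 1.1 (b) (p0003) (`N = 4`)] -/
theorem labels_base_three {S : Finset (ℤ × ℤ)} (hcard : S.card = 4) (hadj : 10 ≤ adjCount S) :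
    ∃ (j : ℕ) (c : ℤ × ℤ), S = (config 1 3).image fun q => rot6^[j] q + c := by
  classical
  obtain ⟨v, hv, hdeg⟩ := exists_lt_card_filter_adj (S := S) (m := 2) (by omega)
  obtain ⟨h0, hc0, ha0, hd0, hSv⟩ := recentre hv
  set S₀ := S.image (fun q => q + -v) with hS₀
  rw [hcard] at hc0
  rw [← ha0] at hadj
  rw [← hd0] at hdeg
  have hsub : S₀ ⊆ hexagon 1 := by
    have h1 : S₀.filter (Adj 0) ⊆ S₀.erase 0 := fun q hq => by
      rw [Finset.mem_filter] at hq
      exact Finset.mem_erase.2 ⟨fun h => not_adj_self 0 (by rw [h] at hq; exact hq.2), hq.1⟩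
    have h2 : (S₀.erase 0).card = 3 := by rw [Finset.card_erase_of_mem h0, hc0]
    have heq : S₀.filter (Adj 0) = S₀.erase 0 := Finset.eq_of_subset_of_card_le h1 (by omega)
    intro q hq
    by_cases hq0 : q = 0
    · rw [hq0]; exact zero_mem_hexagon_one
    · have hq' : q ∈ S₀.filter (Adj 0) := by rw [heq]; exact Finset.mem_erase.2 ⟨hq0, hq⟩
      exact mem_hexagon_one_of_adj_zero (Finset.mem_filter.1 hq').2
  obtain ⟨j, c₀, -, hEq⟩ := labels_three_of_subset_hexagon S₀ (Finset.mem_powerset.2 hsub) hc0 hadj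
  refine ⟨j.val, c₀ + v, ?_⟩
  rw [hSv, hEq, Finset.image_image]
  exact Finset.image_congr fun q _ => by simp only [Function.comp_apply, add_assoc]

/-- **Labels, `N = 5`.** Five labels with `≥ 7` contacts are a rotated translate of `config 1 4`: a label
`v` with `≥ 3` neighbours exists (`14 > 2·5`); either all labels lie in `v + H₁`, or exactly one, `w`, does
not, and then `w` touches a neighbour of `v` (four labels in `H₁` have `≤ 5` contacts), so `w ∈ v + H₂`;
both cases are settled by enumeration. [cite: LucaFriesecke2017, Theorem 1.1 (b) (p0003) (`N = 5`)] -/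
theorem labels_base_four {S : Finset (ℤ × ℤ)} (hcard : S.card = 5) (hadj : 14 ≤ adjCount S) :
    ∃ (j : ℕ) (c : ℤ × ℤ), S = (config 1 4).image fun q => rot6^[j] q + c := by
  classical
  obtain ⟨v, hv, hdeg⟩ := exists_lt_card_filter_adj (S := S) (m := 2) (by omega)
  obtain ⟨h0, hc0, ha0, hd0, hSv⟩ := recentre hv
  set S₀ := S.image (fun q => q + -v) with hS₀
  rw [hcard] at hc0
  rw [← ha0] at hadj
  rw [← hd0] at hdeg
  -- conclusion from a description of `S₀`
  have finish : ∀ (j : Fin 6) (c₀ : ℤ × ℤ), S₀ = (config 1 4).image (fun q => rot6^[j.val] q + c₀) →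
      ∃ (j : ℕ) (c : ℤ × ℤ), S = (config 1 4).image fun q => rot6^[j] q + c := by
    intro j c₀ hEq
    refine ⟨j.val, c₀ + v, ?_⟩
    rw [hSv, hEq, Finset.image_image]
    exact Finset.image_congr fun q _ => by simp only [Function.comp_apply, add_assoc]
  by_cases hsub : S₀ ⊆ hexagon 1
  · obtain ⟨j, c₀, -, hEq⟩ := labels_four_of_subset_hexagon S₀ (Finset.mem_powerset.2 hsub) hc0 hadj
    exact finish j c₀ hEq
  obtain ⟨w, hwS, hw1⟩ := Finset.not_subset.1 hsub
  set N := S₀.erase w with hN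
  have hNc : N.card = 4 := by rw [hN, Finset.card_erase_of_mem hwS, hc0]
  have hw0 : (0 : ℤ × ℤ) ≠ w := fun h => hw1 (h ▸ zero_mem_hexagon_one)
  have hNsub : N ⊆ hexagon 1 := by
    have h1 : insert (0 : ℤ × ℤ) (S₀.filter (Adj 0)) ⊆ N := by
      intro q hq
      rcases Finset.mem_insert.1 hq with rfl | hq
      · exact Finset.mem_erase.2 ⟨hw0, h0⟩
      · have hq' := Finset.mem_filter.1 hq
        exact Finset.mem_erase.2 ⟨fun h => hw1 (h ▸ mem_hexagon_one_of_adj_zero hq'.2), hq'.1⟩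
    have h2 : 4 ≤ (insert (0 : ℤ × ℤ) (S₀.filter (Adj 0))).card := by
      rw [Finset.card_insert_of_notMem fun h => not_adj_self 0 (Finset.mem_filter.1 h).2]
      omega
    have heq := Finset.eq_of_subset_of_card_le h1 (by omega)
    intro q hq
    rw [← heq] at hq
    rcases Finset.mem_insert.1 hq with rfl | hq
    · exact zero_mem_hexagon_one
    · exact mem_hexagon_one_of_adj_zero (Finset.mem_filter.1 hq).2
  have hS₀ : S₀ = insert w N := by rw [hN, Finset.insert_erase hwS]
  have hwN : w ∉ N := fun h => (Finset.mem_erase.1 h).1 rfl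
  have hsplit : adjCount S₀ = adjCount N + 2 * (N.filter (Adj w)).card := by
    rw [hS₀, adjCount_insert hwN]
  have hne : (N.filter (Adj w)).Nonempty := by
    rw [← Finset.card_pos]
    by_contra hz
    have h10 := adjCount_le_ten_of_subset_hexagon N (Finset.mem_powerset.2 hNsub) hNc
    omega
  obtain ⟨p, hp⟩ := hne
  have hw2 : w ∈ hexagon 2 :=
    mem_hexagon_two_of_adj' (hNsub (Finset.mem_filter.1 hp).1) ((adj_comm _ _).1 (Finset.mem_filter.1 hp).2)
  obtain ⟨j, c₀, -, hEq⟩ := labels_four_of_insert N (Finset.mem_powerset.2 hNsub) hNc w hw2 hw1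
    (by rw [← hS₀]; exact hadj)
  rw [← hS₀] at hEq
  exact finish j c₀ hEq

end HarborthSpiral

/-! ## §9 The base cases `k = 3, 4` in a frame, and the theorem -/

namespace Harborth

open HarborthSpiral (rot6 rot6inv config hexagon Inside pos Adj normForm)
open Literature.Topology.PlaneTopology

variable {P : Finset ℂ}

/-- `B(4) = 5`. [cite: Harborth1974, p. 14] -/
theorem harborthNumber_four : harborthNumber 4 = 5 := by
  rw [show (4 : ℕ) = typeB 0 3 by norm_num [typeB], harborthNumber_typeB 0 3 (by norm_num) (by omega)]
  norm_num [typeB]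

/-- `B(5) = 7`. [cite: Harborth1974, p. 14] -/
theorem harborthNumber_five : harborthNumber 5 = 7 := by
  rw [show (5 : ℕ) = typeB 0 4 by norm_num [typeB], harborthNumber_typeB 0 4 (by norm_num) (by omega)]
  norm_num [typeB]

/-- **Base case `k = 3`** (`N = 4`): two triangles sharing a side, `Φ(config 1 3 + c)` in a rotated frame.
[cite: LucaFriesecke2017, Theorem 1.1 (b) (p0003)] -/
theorem base_three (P : Finset ℂ) (_hP : IsHard P) (hcard : P.card = 3 + 1)
    (hmax : 2 * harborthNumber P.card ≤ ((darts P).card : ℤ)) (t u : ℂ) (hu : ‖u‖ = 1)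
    (hlat : ∀ p ∈ P, ∃ q : ℤ × ℤ, p = framePt t u q) :
    ∃ (j : ℕ) (c : ℤ × ℤ), P = (config 1 3).image fun q =>
      framePt t (u * Complex.exp (((π / 3 : ℝ) : ℂ) * I) ^ j) (q + c) := by
  classical
  obtain ⟨S, hPS, hSc, hSd⟩ := exists_labelSet hu hlat
  rw [hcard, harborthNumber_four, hSd] at hmax
  have h10 : 10 ≤ HarborthSpiral.adjCount S := by omega
  obtain ⟨j, c₀, hS⟩ := HarborthSpiral.labels_base_three (by rw [hSc, hcard]) h10
  refine ⟨j, rot6inv^[j] c₀, ?_⟩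
  rw [← image_framePt_rot6_iterate, hPS, hS, Finset.image_image]
  rfl

/-- **Base case `k = 4`** (`N = 5`): the trapezoid, `Φ(config 1 4 + c)` in a rotated frame.
[cite: LucaFriesecke2017, Theorem 1.1 (b) (p0003)] -/
theorem base_four (P : Finset ℂ) (_hP : IsHard P) (hcard : P.card = 4 + 1)
    (hmax : 2 * harborthNumber P.card ≤ ((darts P).card : ℤ)) (t u : ℂ) (hu : ‖u‖ = 1)
    (hlat : ∀ p ∈ P, ∃ q : ℤ × ℤ, p = framePt t u q) :
    ∃ (j : ℕ) (c : ℤ × ℤ), P = (config 1 4).image fun q =>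
      framePt t (u * Complex.exp (((π / 3 : ℝ) : ℂ) * I) ^ j) (q + c) := by
  classical
  obtain ⟨S, hPS, hSc, hSd⟩ := exists_labelSet hu hlat
  rw [hcard, harborthNumber_five, hSd] at hmax
  have h14 : 14 ≤ HarborthSpiral.adjCount S := by omega
  obtain ⟨j, c₀, hS⟩ := HarborthSpiral.labels_base_four (by rw [hSc, hcard]) h14
  refine ⟨j, rot6inv^[j] c₀, ?_⟩
  rw [← image_framePt_rot6_iterate, hPS, hS, Finset.image_image]
  rfl

/-- **De Luca–Friesecke's Theorem 1.1 (b), "if" direction, in a frame.** For `k ≤ 4` and every `s`,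
a maximal configuration of `N(s,k) = 3s² + 3s + 1 + (s+1)k + s` unit discs whose centres lie on the
lattice copy `t + u(ℤ + ℤζ)` is `Φ_{t,uζ^j}(config (s+1) (k(s+1)+s) + c)` for some `j` and `c`.
[cite: LucaFriesecke2017, Theorem 1.1 (b) (p0003)] [cite: HeitmannRadin1980, Theorem (2) p. 284] -/
theorem eq_image_config_of_frame' {k : ℕ} (hk : k ≤ 4) (s : ℕ) (P : Finset ℂ) (hP : IsHard P)
    (hcard : P.card = typeB s k) (hmax : 2 * harborthNumber P.card ≤ ((darts P).card : ℤ))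
    (t u : ℂ) (hu : ‖u‖ = 1) (hlat : ∀ p ∈ P, ∃ q : ℤ × ℤ, p = framePt t u q) :
    ∃ (j : ℕ) (c : ℤ × ℤ), P = (config (s + 1) (k * (s + 1) + s)).image fun q =>
      framePt t (u * Complex.exp (((π / 3 : ℝ) : ℂ) * I) ^ j) (q + c) := by
  refine eq_image_config_of_frame k hk ?_ s P hP hcard hmax t u hu hlat
  intro P hP hc hmax t u hu hlat
  interval_cases k
  · exact base_zero P hP hc hmax t u hu hlat
  · exact base_one P hP hc hmax t u hu hlat
  · exact base_two P hP hc hmax t u hu hlat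
  · exact base_three P hP hc hmax t u hu hlat
  · exact base_four P hP hc hmax t u hu hlat

/-- **Theorem (De Luca–Friesecke 1.1 (b) ⇐ / Heitmann–Radin).** For `k ≤ 4`, every maximal
configuration of `N = 3s² + 3s + 1 + (s+1)k + s` unit discs — hard, with `[3N − √(12N−3)]` contacts — is
the image of Harborth's spiral configuration `config (s+1) (k(s+1)+s)` under a frame map
`q ↦ t + u(q₁ + q₂ζ)`, `|u| = 1`; in particular it is unique up to rotation and translation.
[cite: LucaFriesecke2017, Theorem 1.1 (b) (p0003)] [cite: HeitmannRadin1980, Theorem (2) p. 284]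
[cite: Harborth1974, p. 15] -/
theorem eq_image_config_of_maximal (hP : IsHard P) {s k : ℕ} (hk : k ≤ 4)
    (hcard : P.card = typeB s k) (hmax : 2 * harborthNumber P.card ≤ ((darts P).card : ℤ)) :
    ∃ t u : ℂ, ‖u‖ = 1 ∧ P = (config (s + 1) (k * (s + 1) + s)).image (framePt t u) := by
  classical
  -- a lattice frame containing `P`
  obtain ⟨t, u, hu, hlat⟩ : ∃ t u : ℂ, ‖u‖ = 1 ∧ ∀ p ∈ P, ∃ q : ℤ × ℤ, p = framePt t u q := by
    by_cases h3 : 3 ≤ P.card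
    · have hns : ¬ Splits P := not_splits_of_maximal hP hmax
      have hne : P.Nonempty := Finset.card_pos.1 (by omega)
      have h2 : ∀ p ∈ P, 2 ≤ (nbrs P p).card := fun p hp =>
        two_le_card_nbrs_of_not_splits h3 hns hp
      have ht := tight_or_outer_of_maximal P.card P hP rfl h3 hmax hne h2
      obtain ⟨u, t, hu, hlat⟩ := exists_lattice_of_tight hP hns ht
      exact ⟨t, u, hu, fun p hp => by
        obtain ⟨a, b, hab⟩ := hlat p hp
        exact ⟨(a, b), hab⟩⟩
    · have hpos : 0 < typeB s k := by unfold typeB; positivity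
      by_cases h1 : P.card = 1
      · obtain ⟨p, rfl⟩ := Finset.card_eq_one.1 h1
        refine ⟨p, 1, norm_one, fun p' hp' => ⟨(0, 0), ?_⟩⟩
        rw [Finset.mem_singleton.1 hp']
        simp [framePt]
      · have h2 : P.card = 2 := by omega
        rw [h2, harborthNumber_two] at hmax
        obtain ⟨d, hd⟩ : (darts P).Nonempty := Finset.card_pos.1 (by omega)
        obtain ⟨⟨hx, hy⟩, hd1⟩ := mem_darts.1 hd
        have hxy : d.1 ≠ d.2 := ne_of_mem_darts hd
        have hPeq : P = {d.1, d.2} := by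
          symm
          apply Finset.eq_of_subset_of_card_le
          · intro z hz
            rcases Finset.mem_insert.1 hz with rfl | hz
            · exact hx
            · rw [Finset.mem_singleton.1 hz]; exact hy
          · rw [Finset.card_pair hxy, h2]
        refine ⟨d.1, d.2 - d.1, hd1, fun p hp => ?_⟩
        rw [hPeq, Finset.mem_insert, Finset.mem_singleton] at hp
        rcases hp with rfl | rfl
        · exact ⟨(0, 0), by simp [framePt]⟩
        · exact ⟨(1, 0), by simp [framePt]⟩
  obtain ⟨j, c, hc⟩ := eq_image_config_of_frame' hk s P hP hcard hmax t u hu hlat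
  refine ⟨framePt t (u * Complex.exp (((π / 3 : ℝ) : ℂ) * I) ^ j) c,
    u * Complex.exp (((π / 3 : ℝ) : ℂ) * I) ^ j, norm_mul_zeta_pow hu j, ?_⟩
  rw [hc]
  exact Finset.image_congr fun q _ => framePt_add t _ c q

/-- The same with De Luca–Friesecke's particle number written out and Harborth's count
`#config (s+1) (k(s+1)+s) = N`. [cite: LucaFriesecke2017, Theorem 1.1 (b) (p0003)] -/
theorem eq_image_config_of_maximal' (hP : IsHard P) {s k : ℕ} (hk : k ≤ 4)
    (hcard : P.card = 3 * s ^ 2 + 3 * s + 1 + (s + 1) * k + s)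
    (hmax : 2 * harborthNumber P.card ≤ ((darts P).card : ℤ)) :
    ∃ t u : ℂ, ‖u‖ = 1 ∧ P = (config (s + 1) (k * (s + 1) + s)).image (framePt t u) ∧
      (config (s + 1) (k * (s + 1) + s)).card = P.card := by
  obtain ⟨t, u, hu, h⟩ := eq_image_config_of_maximal hP hk hcard hmax
  exact ⟨t, u, hu, h, by rw [card_config_typeB s k (by omega), hcard, typeB]⟩

end Harborth

end Literature.Geometry.DiscreteGeometry

end
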